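import Summits.QuantumFields.YangMills.Theorems.BalabanUVNodesN21GaussianMillsRatio

/-!
# N21 (NE7c) · two-sided Mills ratio and the DIVERGENT tail ratio `Φ̄((1−κ)z)∕Φ̄(z) → ∞` (lens KT-42a in the comparison model)

R134 seat pub-ymgap-dag-n21-d (g7), node N21 = NE7c (single-run shell-weight bound, NOT PRINTED in [Bałaban 1983–89],
NOT proved), lane K3⁶ `SpineGivenEndpointR13SepCoPR` (stmt-QuantumFields-20509, `--kind proof --supports … --as helper`).
Part 4 of the comparison-model series (`…N21GaussianMillsRatio`, `…GaussianSupDensityBound`, `…GaussianSupDensityBoundHetero`).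

WHAT THIS FILE IS.  The lens memo `ym-lens-BalabanUVNodes-nearmiss/LENS-nearmiss.md` v14.0 Card 42 (`Sketch-nearmiss-g14`
§K5 `lowerMass_iff_largeSideShell`) located, on the SELECTION road for young large-field labels, a lower mass comparison
at the window top that is LITERALLY a large-side shell-versus-tail bound `γ{(1−κ)θ ≤ u} ≤ M₃·γ{θ ≤ u}`, and recorded
kill-test KT-42a: «unbounded in the Gaussian sup model (`M₃ − 1 ≥ Φ̄((1−κ)x)∕Φ̄(x) − 1 → ∞`)».  This file PROVES that
divergence for the standard Gaussian: §1 the UPPER Mills bound `1 − Φ(z) ≤ φ(z)∕z` (`z > 0`, from `∫_{(z,∞)} t·φ(t) dt =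
φ(z)`, FTC-2 on `Ioi`) next to part 1's Gordon LOWER bound, §2 the explicit lower bound
`Φ̄((1−κ)z)∕Φ̄(z) ≥ ((1−κ)z²∕((1−κ)²z² + 1))·exp(κ(2−κ)z²∕2)` for `z > 0`, `0 < κ < 1`, and §3
`tendsto_tailRatio_atTop`: the ratio tends to `+∞` — so NO constant `M₃` serves all thresholds for a Gaussian-tailed slot
variable (the binder is inhabitable only threshold by threshold, with `M₃(θ) ~ e^{κ(2−κ)θ²∕2}`).

HONEST FRAMING.  [textbook] probability, 0 def, 0 sorry; a diagnostic in the comparison model, nothing of Bałaban's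
asserted; NE7c NOT PRINTED ∕ NOT proved; N21 NOT discharged; counts unmoved (typed 28∕28 · discharged 5∕27);
count-neutral; one finite 𝕋⁴ at fixed ε — nothing about ℝ⁴ ∕ OS ∕ mass gap ∕ Clay.
-/

open MeasureTheory ProbabilityTheory Set Filter Topology
open scoped ENNReal NNReal

namespace Summit.QuantumFields.YangMills.Theorems.N21GaussianTailRatio

open Summit.QuantumFields.YangMills.Theorems.N21GaussianMillsRatio

/-! ## §1 `∫_{(z,∞)} t·φ(t) dt = φ(z)` and the upper Mills bound `1 − Φ(z) ≤ φ(z)∕z` -/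

/-- FTC-2 on `(z, ∞)`: `∫_{(z,∞)} t·φ(t) dt = φ(z)` (from `φ′ = −t·φ`, `φ → 0`). [textbook] -/
theorem integral_Ioi_id_mul_gaussianPDFReal (z : ℝ) :
    ∫ t in Ioi z, t * gaussianPDFReal 0 1 t = gaussianPDFReal 0 1 z := by
  have hderiv : ∀ t ∈ Ici z, HasDerivAt (fun t => -gaussianPDFReal 0 1 t) (t * gaussianPDFReal 0 1 t) t := by
    intro t _
    have h := (hasDerivAt_gaussianPDFReal_std t).neg
    refine h.congr_deriv ?_
    ring
  have hint : IntegrableOn (fun t => t * gaussianPDFReal 0 1 t) (Ioi z) := by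
    -- `t ↦ t·φ(t)` is integrable on ℝ: it is `|x|·φ` up to sign, and `gaussianReal 0 1` has all moments
    have h1 : Integrable (fun t : ℝ => t * gaussianPDFReal 0 1 t) := by
      have hm : Integrable id (gaussianReal 0 1) :=
        (memLp_id_gaussianReal (μ := (0 : ℝ)) (v := (1 : ℝ≥0)) 1).integrable le_rfl
      rw [gaussianReal_of_var_ne_zero 0 one_ne_zero, integrable_withDensity_iff_integrable_smul'
        (measurable_gaussianPDF 0 1) (Eventually.of_forall fun _ => gaussianPDF_lt_top)] at hm
      refine hm.congr (Eventually.of_forall fun t => ?_)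
      simp only [toReal_gaussianPDF, smul_eq_mul, id]
      ring
    exact h1.integrableOn
  have hlim : Tendsto (fun t => -gaussianPDFReal 0 1 t) atTop (𝓝 (-0)) := by
    refine Tendsto.neg ?_
    -- 0 ≤ φ(t) ≤ φ(t)·? — squeeze with φ(t) ≤ φ(0)/t·t? simpler: φ(t) ≤ φ(t₀) is not enough; use φ(t) ≤ (√(2π))⁻¹/t · ... via t ≥ 1: φ t ≤ φ t * t
    have hup : Tendsto (fun t : ℝ => (Real.sqrt (2 * Real.pi))⁻¹ / t) atTop (𝓝 0) :=
      tendsto_const_nhds.div_atTop tendsto_id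
    refine tendsto_of_tendsto_of_tendsto_of_le_of_le' tendsto_const_nhds hup ?_ ?_
    · filter_upwards [eventually_gt_atTop 0] with t ht
      exact gaussianPDFReal_nonneg _ _ _
    · filter_upwards [eventually_ge_atTop 1] with t ht
      -- φ(t) ≤ φ(t)·t ≤ ... no: use φ(t) = (√(2π))⁻¹ e^{-t²/2} ≤ (√(2π))⁻¹ e^{-t/2·t} ≤ (√(2π))⁻¹ / t since e^{x} ≥ x hmm
      -- cleaner: e^{t²/2} ≥ 1 + t²/2 ≥ t for all t, so e^{-t²/2} ≤ 1/t for t ≥ 1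
      rw [gaussianPDFReal_std]
      have ht0 : 0 < t := by linarith
      have hexp : t ≤ Real.exp (t ^ 2 / 2) := by
        have h1 : 1 + t ^ 2 / 2 ≤ Real.exp (t ^ 2 / 2) := by
          have := Real.add_one_le_exp (t ^ 2 / 2); linarith
        nlinarith [sq_nonneg (t - 1)]
      have hle : Real.exp (-t ^ 2 / 2) ≤ 1 / t := by
        rw [show -t ^ 2 / 2 = -(t ^ 2 / 2) by ring, Real.exp_neg, one_div]
        exact inv_anti₀ ht0 hexp
      calc (Real.sqrt (2 * Real.pi))⁻¹ * Real.exp (-t ^ 2 / 2) ≤ (Real.sqrt (2 * Real.pi))⁻¹ * (1 / t) :=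
            mul_le_mul_of_nonneg_left hle (by positivity)
        _ = (Real.sqrt (2 * Real.pi))⁻¹ / t := by ring
  have h := integral_Ioi_of_hasDerivAt_of_tendsto' hderiv hint hlim
  rw [h]
  ring

/-- **UPPER MILLS BOUND**: `1 − Φ(z) ≤ φ(z)∕z` for `z > 0` (on `(z, ∞)`, `φ(t) ≤ (t∕z)·φ(t)`). [textbook] -/
theorem one_sub_cdf_std_le_div {z : ℝ} (hz : 0 < z) :
    1 - cdf (gaussianReal 0 1) z ≤ gaussianPDFReal 0 1 z / z := by
  rw [one_sub_cdf_std_eq_integral, le_div_iff₀ hz, ← integral_Ioi_id_mul_gaussianPDFReal z, ← integral_mul_const]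
  refine setIntegral_mono_on ((integrable_gaussianPDFReal 0 1).integrableOn.mul_const _) ?_ measurableSet_Ioi ?_
  · -- integrability of t·φ on Ioi z (as above, globally integrable)
    have hm : Integrable id (gaussianReal 0 1) :=
      (memLp_id_gaussianReal (μ := (0 : ℝ)) (v := (1 : ℝ≥0)) 1).integrable le_rfl
    rw [gaussianReal_of_var_ne_zero 0 one_ne_zero, integrable_withDensity_iff_integrable_smul'
      (measurable_gaussianPDF 0 1) (Eventually.of_forall fun _ => gaussianPDF_lt_top)] at hm
    refine (hm.congr (Eventually.of_forall fun t => ?_)).integrableOn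
    simp only [toReal_gaussianPDF, smul_eq_mul, id]
    ring
  · intro t ht
    have ht' : z ≤ t := le_of_lt ht
    have hφ := gaussianPDFReal_nonneg 0 1 t
    nlinarith

/-- TWO-SIDED MILLS: `z·φ(z)∕(z² + 1) ≤ 1 − Φ(z) ≤ φ(z)∕z` for `z > 0` (part 1's Gordon bound and §1). [textbook] -/
theorem mills_two_sided {z : ℝ} (hz : 0 < z) :
    z * gaussianPDFReal 0 1 z / (z ^ 2 + 1) ≤ 1 - cdf (gaussianReal 0 1) z ∧
      1 - cdf (gaussianReal 0 1) z ≤ gaussianPDFReal 0 1 z / z := by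
  refine ⟨?_, one_sub_cdf_std_le_div hz⟩
  rw [div_le_iff₀ (by positivity)]
  have := gordon_mills hz
  linarith

/-! ## §2 The explicit lower bound on the tail ratio `Φ̄((1−κ)z)∕Φ̄(z)` -/

/-- `φ((1−κ)z)∕φ(z) = exp(κ(2−κ)z²∕2)`. [textbook] -/
theorem gaussianPDFReal_ratio (κ z : ℝ) :
    gaussianPDFReal 0 1 ((1 - κ) * z) = Real.exp (κ * (2 - κ) * z ^ 2 / 2) * gaussianPDFReal 0 1 z := by
  rw [gaussianPDFReal_std, gaussianPDFReal_std]
  have h : -((1 - κ) * z) ^ 2 / 2 = κ * (2 - κ) * z ^ 2 / 2 + -z ^ 2 / 2 := by ring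
  rw [h, Real.exp_add]
  ring

/-- **LOWER BOUND ON THE TAIL RATIO**: for `κ < 1`, `z > 0`,
`((1−κ)z²∕((1−κ)²z² + 1))·exp(κ(2−κ)z²∕2)·(1 − Φ(z)) ≤ 1 − Φ((1−κ)z)` (any `κ < 1`). [textbook] -/
theorem tail_ratio_lower {κ z : ℝ} (hκ1 : κ < 1) (hz : 0 < z) :
    ((1 - κ) * z ^ 2 / ((1 - κ) ^ 2 * z ^ 2 + 1)) * Real.exp (κ * (2 - κ) * z ^ 2 / 2) * (1 - cdf (gaussianReal 0 1) z)
      ≤ 1 - cdf (gaussianReal 0 1) ((1 - κ) * z) := by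
  have hw : 0 < (1 - κ) * z := mul_pos (by linarith) hz
  -- Gordon at w = (1−κ)z:  w φ(w)/(w²+1) ≤ Φ̄(w);   upper Mills at z: Φ̄(z) ≤ φ(z)/z
  have hlow := (mills_two_sided hw).1
  have hup := (mills_two_sided hz).2
  have hφz : 0 < gaussianPDFReal 0 1 z := gaussianPDFReal_pos 0 1 z one_ne_zero
  have hexp : 0 < Real.exp (κ * (2 - κ) * z ^ 2 / 2) := Real.exp_pos _
  rw [gaussianPDFReal_ratio] at hlow
  -- Φ̄(z) ≤ φ(z)/z  ⇒  (stuff ≥ 0) · Φ̄(z) ≤ (stuff) · φ(z)/z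
  have hcoef : 0 ≤ ((1 - κ) * z ^ 2 / ((1 - κ) ^ 2 * z ^ 2 + 1)) * Real.exp (κ * (2 - κ) * z ^ 2 / 2) := by
    have : 0 ≤ 1 - κ := by linarith
    positivity
  calc ((1 - κ) * z ^ 2 / ((1 - κ) ^ 2 * z ^ 2 + 1)) * Real.exp (κ * (2 - κ) * z ^ 2 / 2) * (1 - cdf (gaussianReal 0 1) z)
      ≤ ((1 - κ) * z ^ 2 / ((1 - κ) ^ 2 * z ^ 2 + 1)) * Real.exp (κ * (2 - κ) * z ^ 2 / 2) * (gaussianPDFReal 0 1 z / z) :=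
        mul_le_mul_of_nonneg_left hup hcoef
    _ = (1 - κ) * z * (Real.exp (κ * (2 - κ) * z ^ 2 / 2) * gaussianPDFReal 0 1 z) / (((1 - κ) * z) ^ 2 + 1) := by
        field_simp
    _ ≤ 1 - cdf (gaussianReal 0 1) ((1 - κ) * z) := hlow

/-! ## §3 Divergence: no constant bounds the lowered-threshold tail by the tail (KT-42a) -/

/-- the prefactor is bounded below on `[1, ∞)`: `(1−κ)∕((1−κ)² + 1) ≤ (1−κ)z²∕((1−κ)²z² + 1)` for `z ≥ 1`. [textbook] -/
theorem prefactor_lower {κ z : ℝ} (hκ1 : κ < 1) (hz : 1 ≤ z) :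
    (1 - κ) / ((1 - κ) ^ 2 + 1) ≤ (1 - κ) * z ^ 2 / ((1 - κ) ^ 2 * z ^ 2 + 1) := by
  have h1κ : 0 < 1 - κ := by linarith
  have hz2 : 1 ≤ z ^ 2 := by nlinarith
  rw [div_le_div_iff₀ (by positivity) (by positivity)]
  nlinarith [mul_nonneg h1κ.le (sub_nonneg.2 hz2)]

/-- **THE TAIL RATIO DIVERGES** (lens KT-42a, comparison model): for `0 < κ < 1`,
`(1 − Φ((1−κ)z))∕(1 − Φ(z)) → +∞` as `z → +∞` — a Gaussian-tailed slot variable admits NO threshold-uniform constant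
`M₃` with `P(u ≥ (1−κ)θ) ≤ M₃·P(u ≥ θ)`. [textbook] -/
theorem tendsto_tailRatio_atTop {κ : ℝ} (hκ0 : 0 < κ) (hκ1 : κ < 1) :
    Tendsto (fun z => (1 - cdf (gaussianReal 0 1) ((1 - κ) * z)) / (1 - cdf (gaussianReal 0 1) z)) atTop atTop := by
  set c₀ := (1 - κ) / ((1 - κ) ^ 2 + 1) with hc₀
  have hc₀pos : 0 < c₀ := by
    have : 0 < 1 - κ := by linarith
    positivity
  -- lower comparison function c₀·exp(κ(2−κ)z²/2) → ∞
  have hlow : Tendsto (fun z : ℝ => c₀ * Real.exp (κ * (2 - κ) * z ^ 2 / 2)) atTop atTop := by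
    refine Tendsto.const_mul_atTop hc₀pos ?_
    refine Real.tendsto_exp_atTop.comp ?_
    have hk : 0 < κ * (2 - κ) / 2 := by nlinarith
    have : (fun z : ℝ => κ * (2 - κ) * z ^ 2 / 2) = fun z => κ * (2 - κ) / 2 * z ^ 2 := by
      funext z; ring
    rw [this]
    exact (tendsto_pow_atTop two_ne_zero).const_mul_atTop hk
  refine tendsto_atTop_mono' atTop ?_ hlow
  filter_upwards [eventually_ge_atTop (1 : ℝ)] with z hz
  have hz0 : 0 < z := by linarith
  have htail : 0 < 1 - cdf (gaussianReal 0 1) z := one_sub_cdf_std_pos z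
  rw [le_div_iff₀ htail]
  calc c₀ * Real.exp (κ * (2 - κ) * z ^ 2 / 2) * (1 - cdf (gaussianReal 0 1) z)
      ≤ ((1 - κ) * z ^ 2 / ((1 - κ) ^ 2 * z ^ 2 + 1)) * Real.exp (κ * (2 - κ) * z ^ 2 / 2)
          * (1 - cdf (gaussianReal 0 1) z) := by
        have := prefactor_lower hκ1 hz
        gcongr
    _ ≤ 1 - cdf (gaussianReal 0 1) ((1 - κ) * z) := tail_ratio_lower hκ1 hz0

/-- the same at the level of the Gaussian MEASURE of half-lines: `N(0,1)([(1−κ)θ, ∞)) ∕ N(0,1)([θ, ∞)) → +∞`. [textbook] -/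
theorem tendsto_measure_Ici_ratio_atTop {κ : ℝ} (hκ0 : 0 < κ) (hκ1 : κ < 1) :
    Tendsto (fun θ => (gaussianReal 0 1).real (Ici ((1 - κ) * θ)) / (gaussianReal 0 1).real (Ici θ)) atTop atTop := by
  haveI := nullSingletonClass_gaussianReal (μ := (0 : ℝ)) (v := (1 : ℝ≥0)) one_ne_zero
  have hIci : ∀ a : ℝ, (gaussianReal 0 1).real (Ici a) = 1 - cdf (gaussianReal 0 1) a := fun a => by
    rw [measureReal_congr (Ioi_ae_eq_Ici (μ := gaussianReal 0 1) (a := a)).symm, cdf_eq_real,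
      ← probReal_compl_eq_one_sub measurableSet_Iic, compl_Iic]
  simp only [hIci]
  exact tendsto_tailRatio_atTop hκ0 hκ1

end Summit.QuantumFields.YangMills.Theorems.N21GaussianTailRatio
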